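import Summits.RiemannHypothesis.RiemannHypothesis.Theorems.GroundBartaEvenWinsBeyondArchLatticeRippleClaims
import HarnessLib

/-!
# RiemannHypothesis / GroundBarta machinery — LATTICE RIPPLES (2/2): cells = certified piecewise-polynomial minorants of
cosine sums `P(t) = Σ_r A_r cos(t · (j_r log 2 + k_r log 3))`

Helper file (`--supports stmt-RiemannHypothesis-18085`; infrastructure for the Weil-positivity ladder), RH-free, axioms
standard.  Seat rh-explicit-weil-1 (memo `run/shared/lean/pub/rh-explicit/rh-explicit-weil-1/WEIL1-SIZELAW.md`).

Purpose.  By the phantom-ripple identity (`…PhantomRipples.lean`: `∫ |ĝ(1/2+it)|² · 2cos(tx) dt = 0` for `tsupport g ⊆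
[-c,c]`, `|x| ≥ 2c`) the frequency weight `w₂₃` of the two-prime form `E₂₃` may be replaced by `w₂₃ + P` for any cosine sum
`P` with frequencies `≥ 2c` — in particular the HARMONICS `cos(j t log 2)`, `j log 2 ≥ 2c`, and `cos(k t log 3)`, `k log 3 ≥ 2c`
—, which raises the tail level `inf_{|t| ≥ T} (w₂₃ + P)` of the moment certificates (`CellsOK₂₃.level`) by `≈ 0.9` and so divides
`T` (hence `N ≈ e·a₀·T`) by `≈ 2.5–3`.  On the body `[0, T]` the certificate then needs a certified minorant of `w₂₃ + P`; this
file supplies the `P`-half as an ADDITIVE layer of data-driven cells, by the same mechanism as the prime-`3` ripple of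
`TPDCell` (`WeilTwoPrimeCells.lean`: endpoint constants from the fixed-point engine `FI` + signed Maclaurin brackets):

* (file 1/2, `…LatticeRippleClaims.lean`) `XClaim` — one ripple with its cell-local claims and polynomial minorant;
* `XCell` — an interval `[u, v]` with a list of claims; `XCell.sigma = Σ polyR poly (t − u)`, `XCell.rippleSum = Σ A cos(t x)`,
  the integer checker `XCell.checkZ`, soundness `XCell.sigma_le_Z` (`σ_X ≤ Σ A cos(t x)` on the cell), the sup bound
  `XCell.abs_sigma_le_Z` (`|σ_X| ≤ absQ`), exact moments `XCell.momentQ` (`∫_u^v σ_X(s) s^q ds`), and the check-free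
  validity predicate `XCell.Valid` (`XCell.valid_of_checkZ`) for the chain layer.

Everything here is proved; no named facts.  The frequency data `(j, k)` are integers, so the engine encloses
`x = j log 2 + k log 3` from its own `log 2`, `log 3` (`logTwoFI`, `logThreeFI`); `0 ≤ xlo` is required (flip `(j,k) ↦ (−j,−k)`,
`cos` is even).
-/

set_option linter.dupNamespace false

noncomputable section

open Complex Finset MeasureTheory Set Filter
open scoped Real Topology BigOperators

namespace Summit.RiemannHypothesis.RiemannHypothesis.Theorems.EvenWinsBeyondArch

open Literature.NumberTheory.LFunctions
open Literature.Analysis.ValidatedNumerics.Numerics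
open Literature.Analysis.SpecialFunctions

/-! ## Cells: a list of ripples on `[u, v]` -/

/-- A DATA-DRIVEN cell of a certified minorant of a lattice cosine sum: the interval `[u, v]` and one `XClaim` per
ripple. [folklore] -/
structure XCell where
  /-- left end point -/
  u : ℚ
  /-- right end point -/
  v : ℚ
  /-- the ripples with their cell-local claims -/
  claims : List XClaim

namespace XCell

variable (c : XCell)

/-- The ripple data `(j, k, A)` of the cell (the chain layer requires it to be the same for every cell). [folklore] -/
def ripples : List (ℤ × ℤ × ℚ) := c.claims.map fun r ↦ (r.j, r.k, r.A)

/-- The cosine sum the cell minorises: `Σ_r A_r cos(t x_r)`. [folklore] -/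
def rippleSum (t : ℝ) : ℝ := (c.claims.map fun r ↦ r.val t).sum

/-- The cell polynomial `σ_X(t) = Σ_r poly_r(t − u)`. [folklore] -/
def sigma (t : ℝ) : ℝ := (c.claims.map fun r ↦ polyR r.poly (t - c.u)).sum

/-- `Σ_r absQ_r(v − u)`: an upper bound of `|σ_X|` on the cell. [folklore] -/
def absQ : ℚ := (c.claims.map fun r ↦ r.absQ (c.v - c.u)).sum

/-- **The integer checker of a lattice-ripple cell**: `0 ≤ u < v` and every claim checks on `[u, v]`. [folklore] -/
def checkZ : Bool :=
  decide (0 ≤ c.u) && decide (c.u < c.v) && c.claims.all fun r ↦ r.check c.u c.v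

variable {c}

/-- Unpacking `checkZ`. [folklore] -/
theorem checkZ_spec (h : c.checkZ = true) :
    0 ≤ c.u ∧ c.u < c.v ∧ ∀ r ∈ c.claims, r.check c.u c.v = true := by
  unfold checkZ at h
  simp only [Bool.and_eq_true, decide_eq_true_eq, List.all_eq_true] at h
  exact ⟨h.1.1, h.1.2, h.2⟩

/-- Sum lemma: if every summand of one list is `≤` the corresponding summand of the other. [folklore] -/
theorem sum_map_le_sum_map {l : List XClaim} {f g : XClaim → ℝ} (h : ∀ r ∈ l, f r ≤ g r) :
    (l.map f).sum ≤ (l.map g).sum := by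
  induction l with
  | nil => simp
  | cons r rs ih =>
    simp only [List.map_cons, List.sum_cons]
    exact add_le_add (h r (by simp)) (ih fun r' hr' ↦ h r' (by simp [hr']))

/-- **Cell soundness (integer checker).** On its cell, `σ_X(t) ≤ Σ_r A_r cos(t x_r)`. [folklore] -/
theorem sigma_le_Z (h : c.checkZ = true) {t : ℝ} (hut : (c.u : ℝ) ≤ t) (htv : t ≤ (c.v : ℝ)) :
    c.sigma t ≤ c.rippleSum t := by
  obtain ⟨-, -, hall⟩ := checkZ_spec h
  unfold sigma rippleSum
  exact sum_map_le_sum_map fun r hr ↦ XClaim.polyR_poly_le_of_check (hall r hr) hut htv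

/-- Triangle inequality for list sums. [folklore] -/
theorem abs_sum_map_le {l : List XClaim} {f g : XClaim → ℝ} (h : ∀ r ∈ l, |f r| ≤ g r) :
    |(l.map f).sum| ≤ (l.map g).sum := by
  induction l with
  | nil => simp
  | cons r rs ih =>
    simp only [List.map_cons, List.sum_cons]
    exact (abs_add_le _ _).trans (add_le_add (h r (by simp)) (ih fun r' hr' ↦ h r' (by simp [hr'])))

/-- Cast of `absQ`. [folklore] -/
theorem absQ_cast (c : XCell) : ((c.absQ : ℚ) : ℝ) = (c.claims.map fun r ↦ ((r.absQ (c.v - c.u) : ℚ) : ℝ)).sum := by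
  unfold absQ
  induction c.claims with
  | nil => simp
  | cons r rs ih => rw [List.map_cons, List.sum_cons, List.map_cons, List.sum_cons, Rat.cast_add, ih]

/-- **Sup bound** (from `u ≤ t ≤ v` only): `|σ_X(t)| ≤ absQ`. [folklore] -/
theorem abs_sigma_le_of {t : ℝ} (hut : (c.u : ℝ) ≤ t) (htv : t ≤ (c.v : ℝ)) :
    |c.sigma t| ≤ ((c.absQ : ℚ) : ℝ) := by
  rw [absQ_cast]
  unfold sigma
  refine abs_sum_map_le fun r _ ↦ ?_
  have := XClaim.abs_polyR_poly_le r (h := t - c.u) (w := c.v - c.u) (by linarith) (by push_cast; linarith)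
  exact this

/-- `0 ≤ absQ` (from `u ≤ v`). [folklore] -/
theorem absQ_nonneg_of (huv : c.u ≤ c.v) : 0 ≤ c.absQ := by
  unfold absQ
  have hw : 0 ≤ c.v - c.u := by linarith
  induction c.claims with
  | nil => simp
  | cons r rs ih => simp only [List.map_cons, List.sum_cons]; exact add_nonneg (XClaim.absQ_nonneg r hw) ih

/-- Continuity of a sum of ripple polynomials. [folklore] -/
theorem continuous_polySum (l : List XClaim) (u : ℚ) :
    Continuous fun s : ℝ ↦ (l.map fun r ↦ polyR r.poly (s - u)).sum := by
  induction l with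
  | nil => simpa using continuous_const
  | cons r rs ih =>
    simp only [List.map_cons, List.sum_cons]
    refine Continuous.add ?_ ih
    unfold polyR
    exact continuous_finsetSum _ fun k _ ↦ by fun_prop

/-- Continuity of the cell polynomial. [folklore] -/
theorem continuous_sigma (c : XCell) : Continuous c.sigma := by
  unfold sigma
  exact continuous_polySum c.claims c.u

/-- Continuity of the ripple sum. [folklore] -/
theorem continuous_rippleSum (c : XCell) : Continuous c.rippleSum := by
  unfold rippleSum
  induction c.claims with
  | nil => simpa using continuous_const
  | cons r rs ih =>
    simp only [List.map_cons, List.sum_cons]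
    refine Continuous.add ?_ ih
    unfold XClaim.val
    fun_prop

/-! ### Exact moments of a lattice-ripple cell -/

/-- `(v^e − u^e)/e` (`= ∫_u^v s^{e−1} ds` for `e ≥ 1`). [folklore] -/
def powIntQ (c : XCell) (e : ℕ) : ℚ := (c.v ^ e - c.u ^ e) / e

/-- `∫_u^v s^e ds = powIntQ (e+1)`. [folklore] -/
theorem integral_pow_eq_powIntQ (c : XCell) (e : ℕ) :
    ∫ s in (c.u : ℝ)..c.v, s ^ e = (c.powIntQ (e + 1) : ℝ) := by
  rw [integral_pow, powIntQ]
  push_cast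
  ring

/-- `∫_u^v (s − u)^i s^q ds` in closed form: `Σ_l C(i,l) (−u)^{i−l} (v^{l+q+1} − u^{l+q+1})/(l+q+1)`. [folklore] -/
def shiftPowIntQ (c : XCell) (i q : ℕ) : ℚ :=
  sumR (i + 1) fun l ↦ ((i.choose l : ℕ) : ℚ) * (-c.u) ^ (i - l) * c.powIntQ (l + q + 1)

/-- `∫_u^v (s − u)^i s^q ds = shiftPowIntQ i q`. [folklore] -/
theorem integral_shift_pow_mul_pow (c : XCell) (i q : ℕ) :
    ∫ s in (c.u : ℝ)..c.v, (s - c.u) ^ i * s ^ q = (c.shiftPowIntQ i q : ℝ) := by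
  have hexp : ∀ s : ℝ, (s - c.u) ^ i * s ^ q =
      ∑ l ∈ Finset.range (i + 1), ((i.choose l : ℕ) : ℝ) * (-(c.u : ℝ)) ^ (i - l) * s ^ (l + q) := by
    intro s
    rw [sub_eq_add_neg, add_pow, Finset.sum_mul]
    refine Finset.sum_congr rfl fun l _ ↦ ?_
    rw [pow_add]; ring
  simp_rw [hexp]
  rw [intervalIntegral.integral_finsetSum
    (f := fun l s ↦ ((i.choose l : ℕ) : ℝ) * (-(c.u : ℝ)) ^ (i - l) * s ^ (l + q))
    (fun l _ ↦ (by fun_prop : Continuous fun s : ℝ ↦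
      ((i.choose l : ℕ) : ℝ) * (-(c.u : ℝ)) ^ (i - l) * s ^ (l + q)).intervalIntegrable _ _)]
  unfold shiftPowIntQ
  rw [sumR_eq_sum]
  push_cast
  refine Finset.sum_congr rfl fun l _ ↦ ?_
  rw [intervalIntegral.integral_const_mul, integral_pow_eq_powIntQ]

/-- The moment of one ripple polynomial: `Σ_i p_i ∫_u^v (s − u)^i s^q ds`. [folklore] -/
def claimMomentQ (c : XCell) (r : XClaim) (q : ℕ) : ℚ :=
  sumR (r.n + 1) fun i ↦ getV r.poly i * c.shiftPowIntQ i q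

/-- `∫_u^v poly_r(s − u) s^q ds = claimMomentQ`. [folklore] -/
theorem integral_polyR_poly_mul_pow (c : XCell) (r : XClaim) (q : ℕ) :
    ∫ s in (c.u : ℝ)..c.v, polyR r.poly (s - c.u) * s ^ q = (c.claimMomentQ r q : ℝ) := by
  have hpt : ∀ s : ℝ, polyR r.poly (s - c.u) * s ^ q =
      ∑ i ∈ Finset.range (r.n + 1), ((getV r.poly i : ℚ) : ℝ) * ((s - c.u) ^ i * s ^ q) := by
    intro s
    unfold polyR
    rw [XClaim.length_poly, Finset.sum_mul]
    exact Finset.sum_congr rfl fun i _ ↦ by ring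
  simp_rw [hpt]
  have iK : ∀ i, IntervalIntegrable
      (fun s : ℝ ↦ ((getV r.poly i : ℚ) : ℝ) * ((s - c.u) ^ i * s ^ q)) volume c.u c.v :=
    fun i ↦ (continuous_const.mul ((continuous_pow i |>.comp (continuous_sub_right _)).mul
      (continuous_pow q))).intervalIntegrable _ _
  rw [intervalIntegral.integral_finsetSum fun i _ ↦ iK i]
  unfold claimMomentQ
  rw [sumR_eq_sum]
  push_cast
  refine Finset.sum_congr rfl fun i _ ↦ ?_
  rw [intervalIntegral.integral_const_mul, integral_shift_pow_mul_pow]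

/-- `∫_u^v σ_X(s) s^q ds` in closed form. [folklore] -/
def momentQ (c : XCell) (q : ℕ) : ℚ := (c.claims.map fun r ↦ c.claimMomentQ r q).sum

/-- **Cell moments.** `∫_u^v σ_X(s) s^q ds = momentQ q`. [folklore] -/
theorem integral_sigma_mul_pow (c : XCell) (q : ℕ) :
    ∫ s in (c.u : ℝ)..c.v, c.sigma s * s ^ q = (c.momentQ q : ℝ) := by
  unfold sigma momentQ
  induction c.claims with
  | nil => simp
  | cons r rs ih =>
    simp only [List.map_cons, List.sum_cons]
    have e : (fun s : ℝ ↦ (polyR r.poly (s - c.u) + (rs.map fun r' ↦ polyR r'.poly (s - c.u)).sum) * s ^ q) =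
        fun s : ℝ ↦ polyR r.poly (s - c.u) * s ^ q + (rs.map fun r' ↦ polyR r'.poly (s - c.u)).sum * s ^ q := by
      funext s; ring
    rw [e]
    have hc1 : Continuous fun s : ℝ ↦ polyR r.poly (s - c.u) * s ^ q := by
      unfold polyR; fun_prop
    have hc2 : Continuous fun s : ℝ ↦ (rs.map fun r' ↦ polyR r'.poly (s - c.u)).sum * s ^ q :=
      (continuous_polySum rs c.u).mul (continuous_pow q)
    rw [intervalIntegral.integral_add (hc1.intervalIntegrable _ _) (hc2.intervalIntegrable _ _),
      integral_polyR_poly_mul_pow, ih]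
    push_cast
    ring

/-! ### Valid cells -/

/-- What the chain layer uses about a lattice-ripple cell: `0 ≤ u < v`, `σ_X ≤ Σ A cos(t x)` on the cell,
`|σ_X| ≤ absQ` on the cell, `0 ≤ absQ`. [folklore] -/
structure Valid (c : XCell) : Prop where
  /-- `0 ≤ u` -/
  u_nonneg : 0 ≤ c.u
  /-- `u < v` -/
  u_lt_v : c.u < c.v
  /-- `σ_X ≤ Σ_r A_r cos(t x_r)` on the cell -/
  sigma_le : ∀ t : ℝ, (c.u : ℝ) ≤ t → t ≤ c.v → c.sigma t ≤ c.rippleSum t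
  /-- `|σ_X| ≤ absQ` on the cell -/
  abs_le : ∀ t : ℝ, (c.u : ℝ) ≤ t → t ≤ c.v → |c.sigma t| ≤ c.absQ
  /-- `0 ≤ absQ` -/
  absQ_nonneg : 0 ≤ c.absQ

/-- An integer-checked cell is valid. [folklore] -/
theorem valid_of_checkZ (h : c.checkZ = true) : c.Valid := by
  obtain ⟨hu, huv, -⟩ := checkZ_spec h
  exact ⟨hu, huv, fun _t hut htv ↦ sigma_le_Z h hut htv, fun _t hut htv ↦ abs_sigma_le_of hut htv,
    absQ_nonneg_of huv.le⟩

end XCell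

end Summit.RiemannHypothesis.RiemannHypothesis.Theorems.EvenWinsBeyondArch

end
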